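import Mathlib

/-!
# Crux `RefutationBarrier` (stmt-ValiantsHypothesis-5642), line `Sketch_ideator5`, stub D1
`stub_border_gap_dichotomy` — auxiliary file: first-order conditions of minimal-energy tuples

Card `balanced-singular-limits` (Kempf–Ness confinement of border gaps).  For a finite family
`M : ι → Matrix (Fin m) (Fin m) ℂ` write `E(M) = Σ_t ‖M_t‖_F² = Σ_t Σ_a Σ_b |M t a b|²` for its
energy.  If `E` does not decrease under LEFT multiplication of the family by any matrix of
determinant `1` (`E(M) ≤ E(g • M)`), then testing with the elementary one-parameter families
`g = transvection i j s` (`s ∈ ℂ`) and `g = diag(…, c, …, c⁻¹, …)` (`c > 0`) gives the first-order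
(moment map) conditions: `S := Σ_t M_t M_tᴴ` has vanishing off-diagonal entries and equal diagonal
entries (`borderGap_left_firstOrder`).  The RIGHT version (`Σ_t M_tᴴ M_t`) follows by transposing
(`borderGap_right_firstOrder`), and with the trace identity `tr S = E(M)` both conditions together
say that the family is BALANCED: `Σ_t M_t M_tᴴ = (E/m)·1 = Σ_t M_tᴴ M_t`
(`borderGap_family_balanced`).  Only elementary real/complex arithmetic is used (no Lie theory, no
derivatives): the two scalar lemmas `borderGap_eq_zero_of_forall_re` and
`borderGap_le_of_forall_sq` extract the conditions from the inequalities.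

References: Kempf–Ness 1979 (minimal vectors), Gurvits 2004 / Garg–Gurvits–Oliveira–Wigderson 2016
(operator scaling; balanced = doubly stochastic tuples).  All statements here are folklore.
-/

set_option linter.dupNamespace false

noncomputable section

namespace Summit.ValiantsHypothesis.ValiantsHypothesis.Theorems.RefutationDegree

open scoped BigOperators
open Matrix

/-! ## Scalar lemmas -/

/-- Polarisation of the squared norm: `|x + s y|² − |x|² = 2 Re( s̄ · x ȳ ) + |s|² |y|²`. [folklore] -/
private theorem borderGap_norm_add_mul_sq (x y s : ℂ) :
    ‖x + s * y‖ ^ 2 - ‖x‖ ^ 2 =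
      2 * (starRingEnd ℂ s * (x * starRingEnd ℂ y)).re + ‖s‖ ^ 2 * ‖y‖ ^ 2 := by
  simp only [Complex.sq_norm, Complex.normSq_apply, Complex.add_re, Complex.add_im, Complex.mul_re,
    Complex.mul_im, Complex.conj_re, Complex.conj_im]
  ring

/-- If `2 Re(s̄ w) + |s|² r ≥ 0` for every complex `s`, then `w = 0` (test `s = −ε w`). [folklore] -/
private theorem borderGap_eq_zero_of_forall_re (w : ℂ) (r : ℝ)
    (h : ∀ s : ℂ, 0 ≤ 2 * (starRingEnd ℂ s * w).re + ‖s‖ ^ 2 * r) : w = 0 := by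
  by_contra hw
  set ε : ℝ := 1 / (|r| + 1) with hε
  have hε0 : 0 < ε := by positivity
  have hεr : ε * r < 2 := by
    have h1 : ε * r ≤ ε * |r| := mul_le_mul_of_nonneg_left (le_abs_self r) hε0.le
    have h2 : ε * |r| < 1 := by
      rw [hε, one_div, inv_mul_lt_iff₀ (by positivity)]
      linarith [abs_nonneg r]
    linarith
  have hw2 : 0 < ‖w‖ ^ 2 := by positivity
  have key := h (-(ε : ℂ) * w)
  have h1 : (starRingEnd ℂ (-(ε : ℂ) * w) * w).re = -ε * ‖w‖ ^ 2 := by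
    rw [map_mul, map_neg, Complex.conj_ofReal, mul_assoc, Complex.conj_mul', ← Complex.ofReal_pow,
      ← Complex.ofReal_neg, ← Complex.ofReal_mul, Complex.ofReal_re]
  have h2 : ‖-(ε : ℂ) * w‖ ^ 2 = ε ^ 2 * ‖w‖ ^ 2 := by
    rw [norm_mul, norm_neg, Complex.norm_real, Real.norm_eq_abs, abs_of_pos hε0, mul_pow]
  rw [h1, h2] at key
  have h3 : 2 * (-ε * ‖w‖ ^ 2) + ε ^ 2 * ‖w‖ ^ 2 * r = (ε * ‖w‖ ^ 2) * (ε * r - 2) := by ring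
  rw [h3] at key
  have hneg : (ε * ‖w‖ ^ 2) * (ε * r - 2) < 0 :=
    mul_neg_of_pos_of_neg (by positivity) (by linarith)
  linarith

/-- If `a + b ≤ c² a + c⁻² b` for every real `c > 0` (and `a ≥ 0`), then `b ≤ a`
(test `c² = 1 + δ` with `δ` small). [folklore] -/
private theorem borderGap_le_of_forall_sq (a b : ℝ) (ha : 0 ≤ a)
    (h : ∀ c : ℝ, 0 < c → a + b ≤ c ^ 2 * a + (c ^ 2)⁻¹ * b) : b ≤ a := by
  by_contra hab
  push Not at hab
  set δ : ℝ := (b - a) / (a + 1) with hδ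
  have hδ0 : 0 < δ := div_pos (sub_pos.mpr hab) (by linarith)
  have hδa : a * δ + δ = b - a := by
    rw [hδ]
    field_simp
  have hu0 : (0 : ℝ) < 1 + δ := by linarith
  have key := h (Real.sqrt (1 + δ)) (Real.sqrt_pos.mpr hu0)
  rw [Real.sq_sqrt hu0.le] at key
  have key2 := mul_le_mul_of_nonneg_left key hu0.le
  have hcalc : (1 + δ) * ((1 + δ) * a + (1 + δ)⁻¹ * b) = (1 + δ) * ((1 + δ) * a) + b := by
    field_simp
  rw [hcalc] at key2
  have hid : (1 + δ) * ((1 + δ) * a) + b - (1 + δ) * (a + b) = -δ ^ 2 := by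
    linear_combination δ * hδa
  nlinarith [pow_pos hδ0 2]

/-! ## First-order conditions for families of matrices -/

/-- **Left first-order conditions.**  If the energy `Σ_t ‖M_t‖_F²` of a finite family of square
complex matrices does not decrease under left multiplication by matrices of determinant one, then
`S = Σ_t M_t M_tᴴ` has zero off-diagonal entries (test with transvections) and equal diagonal
entries (test with `diag(c, c⁻¹)`). [folklore] -/
theorem borderGap_left_firstOrder {ι : Type*} [Fintype ι] {m : ℕ}
    (M : ι → Matrix (Fin m) (Fin m) ℂ)
    (hl : ∀ g : Matrix (Fin m) (Fin m) ℂ, g.det = 1 →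
      ∑ t, ∑ a, ∑ b, ‖M t a b‖ ^ 2 ≤ ∑ t, ∑ a, ∑ b, ‖(g * M t) a b‖ ^ 2) :
    (∀ i j : Fin m, i ≠ j → (∑ t, M t * (M t)ᴴ) i j = 0) ∧
      ∀ i j : Fin m, (∑ t, M t * (M t)ᴴ) i i = (∑ t, M t * (M t)ᴴ) j j := by
  classical
  have hS : ∀ i j : Fin m,
      (∑ t, M t * (M t)ᴴ) i j = ∑ t, ∑ b, M t i b * starRingEnd ℂ (M t j b) := by
    intro i j
    simp only [Matrix.sum_apply, Matrix.mul_apply, Matrix.conjTranspose_apply, Complex.star_def]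
  -- (1) transvections `1 + s E_{ij}`: row `i` becomes `row i + s · row j`
  have htrans : ∀ i j : Fin m, i ≠ j → ∀ s : ℂ,
      ∑ t, ∑ a, ∑ b, ‖(Matrix.transvection i j s * M t) a b‖ ^ 2 =
        ∑ t, ∑ a, ∑ b, ‖M t a b‖ ^ 2 +
          (2 * (starRingEnd ℂ s * ∑ t, ∑ b, M t i b * starRingEnd ℂ (M t j b)).re +
            ‖s‖ ^ 2 * ∑ t, ∑ b, ‖M t j b‖ ^ 2) := by
    intro i j hij s
    rw [← sub_eq_iff_eq_add']
    simp only [← Finset.sum_sub_distrib]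
    have hrow : ∀ t b, ∑ a, (‖(Matrix.transvection i j s * M t) a b‖ ^ 2 - ‖M t a b‖ ^ 2) =
        ‖M t i b + s * M t j b‖ ^ 2 - ‖M t i b‖ ^ 2 := by
      intro t b
      rw [Finset.sum_eq_single i]
      · rw [Matrix.transvection_mul_apply_same]
      · intro a _ ha
        rw [Matrix.transvection_mul_apply_of_ne i j a b ha, sub_self]
      · intro h
        exact absurd (Finset.mem_univ i) h
    calc ∑ t, ∑ a, ∑ b, (‖(Matrix.transvection i j s * M t) a b‖ ^ 2 - ‖M t a b‖ ^ 2)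
        = ∑ t, ∑ b, (‖M t i b + s * M t j b‖ ^ 2 - ‖M t i b‖ ^ 2) := by
          refine Finset.sum_congr rfl fun t _ => ?_
          rw [Finset.sum_comm]
          exact Finset.sum_congr rfl fun b _ => hrow t b
      _ = ∑ t, ∑ b, (2 * (starRingEnd ℂ s * (M t i b * starRingEnd ℂ (M t j b))).re +
            ‖s‖ ^ 2 * ‖M t j b‖ ^ 2) := by
          simp only [borderGap_norm_add_mul_sq]
      _ = _ := by
          simp only [Finset.sum_add_distrib, Finset.mul_sum, Complex.re_sum]
  have hoff : ∀ i j : Fin m, i ≠ j → ∑ t, ∑ b, M t i b * starRingEnd ℂ (M t j b) = 0 := by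
    intro i j hij
    refine borderGap_eq_zero_of_forall_re _ (∑ t, ∑ b, ‖M t j b‖ ^ 2) fun s => ?_
    have h := hl (Matrix.transvection i j s) (Matrix.det_transvection_of_ne i j hij s)
    rw [htrans i j hij s] at h
    linarith
  -- (2) diagonal `diag(…, c at i, …, c⁻¹ at j, …)`: row `i` scaled by `c`, row `j` by `c⁻¹`
  have hdiagE : ∀ i j : Fin m, i ≠ j → ∀ c : ℝ, 0 < c →
      ∑ t, ∑ a, ∑ b, ‖(Matrix.diagonal (fun a : Fin m =>
          if a = i then (c : ℂ) else if a = j then (c : ℂ)⁻¹ else 1) * M t) a b‖ ^ 2 =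
        ∑ t, ∑ a, ∑ b, ‖M t a b‖ ^ 2 +
          ((c ^ 2 - 1) * ∑ t, ∑ b, ‖M t i b‖ ^ 2 +
            ((c ^ 2)⁻¹ - 1) * ∑ t, ∑ b, ‖M t j b‖ ^ 2) := by
    intro i j hij c hc
    set d : Fin m → ℂ := fun a => if a = i then (c : ℂ) else if a = j then (c : ℂ)⁻¹ else 1
      with hd
    have hdi : d i = c := by simp [hd]
    have hdj : d j = (c : ℂ)⁻¹ := by simp [hd, Ne.symm hij]
    have hdo : ∀ a, a ≠ i → a ≠ j → d a = 1 := fun a hai haj => by simp [hd, hai, haj]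
    rw [← sub_eq_iff_eq_add']
    simp only [← Finset.sum_sub_distrib, Matrix.diagonal_mul, norm_mul, mul_pow, ← sub_one_mul]
    have hre : ∀ t, ∑ a, ∑ b, (‖d a‖ ^ 2 - 1) * ‖M t a b‖ ^ 2 =
        (c ^ 2 - 1) * ∑ b, ‖M t i b‖ ^ 2 + ((c ^ 2)⁻¹ - 1) * ∑ b, ‖M t j b‖ ^ 2 := by
      intro t
      rw [Finset.sum_eq_add_of_mem i j (Finset.mem_univ i) (Finset.mem_univ j) hij]
      · rw [hdi, hdj, norm_inv, inv_pow, Complex.norm_real, Real.norm_eq_abs, sq_abs,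
          Finset.mul_sum, Finset.mul_sum]
      · rintro a - ⟨hai, haj⟩
        rw [hdo a hai haj, norm_one, one_pow, sub_self]
        simp
    simp only [hre, Finset.sum_add_distrib, Finset.mul_sum]
  have hrowle : ∀ i j : Fin m, i ≠ j → ∑ t, ∑ b, ‖M t j b‖ ^ 2 ≤ ∑ t, ∑ b, ‖M t i b‖ ^ 2 := by
    intro i j hij
    refine borderGap_le_of_forall_sq _ _ (by positivity) fun c hc => ?_
    have hdet : (Matrix.diagonal (fun a : Fin m =>
        if a = i then (c : ℂ) else if a = j then (c : ℂ)⁻¹ else 1)).det = 1 := by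
      rw [Matrix.det_diagonal,
        Finset.prod_eq_mul_of_mem i j (Finset.mem_univ i) (Finset.mem_univ j) hij]
      · have hc0 : (c : ℂ) ≠ 0 := Complex.ofReal_ne_zero.mpr hc.ne'
        simp [Ne.symm hij, hc0]
      · rintro a - ⟨hai, haj⟩
        simp [hai, haj]
    have h := hl _ hdet
    rw [hdiagE i j hij c hc] at h
    linarith
  have hdiag : ∀ i : Fin m, (∑ t, M t * (M t)ᴴ) i i = ((∑ t, ∑ b, ‖M t i b‖ ^ 2 : ℝ) : ℂ) := by
    intro i
    rw [hS]
    simp only [Complex.mul_conj', Complex.ofReal_sum, Complex.ofReal_pow]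
  refine ⟨fun i j hij => by rw [hS]; exact hoff i j hij, fun i j => ?_⟩
  rcases eq_or_ne i j with rfl | hij
  · rfl
  · rw [hdiag, hdiag, le_antisymm (hrowle j i hij.symm) (hrowle i j hij)]

/-- **Right first-order conditions** (columns instead of rows), deduced from the left ones applied
to the transposed family: `Σ_t M_tᴴ M_t` has zero off-diagonal and equal diagonal entries.
[folklore] -/
theorem borderGap_right_firstOrder {ι : Type*} [Fintype ι] {m : ℕ}
    (M : ι → Matrix (Fin m) (Fin m) ℂ)
    (hr : ∀ h : Matrix (Fin m) (Fin m) ℂ, h.det = 1 →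
      ∑ t, ∑ a, ∑ b, ‖M t a b‖ ^ 2 ≤ ∑ t, ∑ a, ∑ b, ‖(M t * h) a b‖ ^ 2) :
    (∀ i j : Fin m, i ≠ j → (∑ t, (M t)ᴴ * M t) i j = 0) ∧
      ∀ i j : Fin m, (∑ t, (M t)ᴴ * M t) i i = (∑ t, (M t)ᴴ * M t) j j := by
  have hE : ∀ N : ι → Matrix (Fin m) (Fin m) ℂ,
      ∑ t, ∑ a, ∑ b, ‖(N t)ᵀ a b‖ ^ 2 = ∑ t, ∑ a, ∑ b, ‖N t a b‖ ^ 2 := fun N =>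
    Finset.sum_congr rfl fun t _ => by
      simp only [Matrix.transpose_apply]
      rw [Finset.sum_comm]
  have hl := borderGap_left_firstOrder (fun t => (M t)ᵀ) fun g hg => by
    have h1 := hr gᵀ (by rw [Matrix.det_transpose, hg])
    have h2 : ∀ t, g * (M t)ᵀ = (M t * gᵀ)ᵀ := fun t => by
      rw [Matrix.transpose_mul, Matrix.transpose_transpose]
    simp only [h2]
    rw [hE M, hE (fun t => M t * gᵀ)]
    exact h1
  have hentry : ∀ i j : Fin m,
      (∑ t, (M t)ᴴ * M t) i j = (∑ t, (M t)ᵀ * ((M t)ᵀ)ᴴ) j i := by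
    intro i j
    simp only [Matrix.sum_apply, Matrix.mul_apply, Matrix.conjTranspose_apply,
      Matrix.transpose_apply]
    exact Finset.sum_congr rfl fun t _ => Finset.sum_congr rfl fun b _ => mul_comm _ _
  refine ⟨fun i j hij => ?_, fun i j => ?_⟩
  · rw [hentry]
    exact hl.1 j i hij.symm
  · rw [hentry, hentry]
    exact hl.2 i j

/-- **Minimal energy under `SL_m × SL_m` forces balance.**  If the energy `E = Σ_t ‖M_t‖_F²` of a
finite family of `m × m` complex matrices does not decrease under left nor under right
multiplication by matrices of determinant one, then `Σ_t M_t M_tᴴ = (E/m)·1 = Σ_t M_tᴴ M_t`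
(first-order conditions plus the trace identity `tr Σ_t M_t M_tᴴ = E`). [folklore] -/
theorem borderGap_family_balanced {ι : Type*} [Fintype ι] {m : ℕ}
    (M : ι → Matrix (Fin m) (Fin m) ℂ)
    (hl : ∀ g : Matrix (Fin m) (Fin m) ℂ, g.det = 1 →
      ∑ t, ∑ a, ∑ b, ‖M t a b‖ ^ 2 ≤ ∑ t, ∑ a, ∑ b, ‖(g * M t) a b‖ ^ 2)
    (hr : ∀ h : Matrix (Fin m) (Fin m) ℂ, h.det = 1 →
      ∑ t, ∑ a, ∑ b, ‖M t a b‖ ^ 2 ≤ ∑ t, ∑ a, ∑ b, ‖(M t * h) a b‖ ^ 2) :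
    (∑ t, M t * (M t)ᴴ) =
        (((∑ t, ∑ a, ∑ b, ‖M t a b‖ ^ 2) / m : ℝ) : ℂ) • (1 : Matrix (Fin m) (Fin m) ℂ) ∧
      (∑ t, (M t)ᴴ * M t) =
        (((∑ t, ∑ a, ∑ b, ‖M t a b‖ ^ 2) / m : ℝ) : ℂ) • (1 : Matrix (Fin m) (Fin m) ℂ) := by
  classical
  rcases Nat.eq_zero_or_pos m with rfl | hm
  · exact ⟨Subsingleton.elim _ _, Subsingleton.elim _ _⟩
  obtain ⟨hoff, hdiag⟩ := borderGap_left_firstOrder M hl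
  obtain ⟨hoff', hdiag'⟩ := borderGap_right_firstOrder M hr
  set E : ℝ := ∑ t, ∑ a, ∑ b, ‖M t a b‖ ^ 2 with hEdef
  have htr : ∑ i, (∑ t, M t * (M t)ᴴ) i i = (E : ℂ) := by
    simp only [Matrix.sum_apply, Matrix.mul_apply, Matrix.conjTranspose_apply, Complex.star_def,
      Complex.mul_conj', hEdef, Complex.ofReal_sum, Complex.ofReal_pow]
    rw [Finset.sum_comm]
  have htr' : ∑ i, (∑ t, (M t)ᴴ * M t) i i = (E : ℂ) := by
    simp only [Matrix.sum_apply, Matrix.mul_apply, Matrix.conjTranspose_apply, Complex.star_def,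
      Complex.conj_mul', hEdef, Complex.ofReal_sum, Complex.ofReal_pow]
    rw [Finset.sum_comm]
    exact Finset.sum_congr rfl fun t _ => Finset.sum_comm
  have hm0 : (m : ℂ) ≠ 0 := Nat.cast_ne_zero.mpr hm.ne'
  have key : ∀ S : Matrix (Fin m) (Fin m) ℂ, (∀ i j, i ≠ j → S i j = 0) →
      (∀ i j, S i i = S j j) → ∑ i, S i i = (E : ℂ) →
        S = ((E / m : ℝ) : ℂ) • (1 : Matrix (Fin m) (Fin m) ℂ) := by
    intro S h1 h2 h3
    have hii : ∀ i, S i i = ((E / m : ℝ) : ℂ) := by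
      intro i
      have h4 : ∑ k, S k k = ∑ _k : Fin m, S i i := Finset.sum_congr rfl fun k _ => h2 k i
      rw [h3, Finset.sum_const, Finset.card_univ, Fintype.card_fin, nsmul_eq_mul] at h4
      rw [Complex.ofReal_div, Complex.ofReal_natCast, h4, mul_div_cancel_left₀ _ hm0]
    ext i j
    by_cases hij : i = j
    · subst hij
      simp [hii]
    · simp [h1 i j hij, hij]
  exact ⟨key _ hoff hdiag htr, key _ hoff' hdiag' htr'⟩

end Summit.ValiantsHypothesis.ValiantsHypothesis.Theorems.RefutationDegree

end
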